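import Summits.Ventures.DiscreteObjects.Hadamard.Order334NegaPair668
import Summits.Ventures.DiscreteObjects.Hadamard.Order167CirculantArray668

/-!
# H(668): an automorphism of order 334 is EXACTLY a 2 × 2 array of negacyclic blocks of order 334 (kernel)

Framing: lottery ticket; floor = certified bounds/negative ranges.

Cell pub-namedobj (venture DiscreteObjects), target (H), hadamard gen 19.  The nega analogue of `Order167CirculantArray668` and the
matrix form of `Order334NegaPair668`.  A NEGACYCLIC block of order `334` on an antiperiodic `±1` sequence `x : ZMod 668 → ℤ`
(`x (r + 334) = −x r`) is `N (s, t) = x (t − s)`, the difference read in `ZMod 668` through the lifts `s.val, t.val` of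
`s, t ∈ ZMod 334` (so `N (s, t) = x (t − s)` above the diagonal and `−x (t − s + 334)` below it).
* **`exists_negacyclicArray_of_hadamard668_signedAut_334`**: a Hadamard matrix of order `668` with a signed automorphism of pair
  order `334` yields four antiperiodic `±1` sequences `x p q` (`p, q ∈ Fin 2`) such that the `2 × 2` array of negacyclic blocks
  `M (p, s) (q, t) = x p q (↑t.val − ↑s.val)` on `Fin 2 × ZMod 334` is a Hadamard matrix of order `668`.  [Gen 12: two regular
  orbits of length `334` on each side, all cycle sign products `−1`; the orbit maps `(p, s) ↦ π^s x_p` are bijections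
  (`orbitMap_unique`, gen 19); re-sign rows by `cyc_π(x_p, s)` and columns by `cyc_κ(y_q, t)`; the signed iteration
  `H (π^m i) (κ^m j) = cyc_π cyc_κ H i j` and the 668-periodicity / 334-antiperiodicity of the partial cycle products identify the
  entry with the signed cycle sequence `ã_{pq}(r) = cyc_κ(y_q, r)·H x_p (κ^r y_q)` of `Order334NegaPair668` at `r = t − s`.]
* **`hadamard668_negacyclicArray_aut334`** (converse): such an array has the signed shift `(p, s) ↦ (p, s + 1)` with sign `−1`
  on the wrapping index `s = 333` as a signed automorphism of pair order `334`.
* **`hadamard668_aut334_iff_negacyclicArray`**: *some H(668) has a signed automorphism with `orderOf (π, κ) = 334` iff some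
  H(668) is a `2 × 2` array of negacyclic `±1` blocks of order `334`* (the two-negacirculant / Ito–Williamson-type shape; the
  first block row is the negaperiodic complementary pair of `Order334NegaPair668`).
Dictionary / structure of a hypothetical object; H(668) untouched.  Ours; no `sorry`, no definitions.
-/

namespace Summit.Ventures.DiscreteObjects.Hadamard

open Finset BigOperators Matrix

open Literature.Combinatorics.Designs.GoethalsSeidel (IsHadamardMatrix)
open Literature.Combinatorics.Designs.LegendrePairs (IsPM)

variable {ι : Type*} [Fintype ι] [DecidableEq ι]

/-- **Orbit coordinates, order 334.**  If all points are listed by the `κ`-cycles of length `334` of a `2`-element transversal,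
the orbit map `Fin 2 × ZMod 334 → ι` is a bijection. -/
lemma orbitMap_bijective_334 (κ : Equiv.Perm ι) (hι : Fintype.card ι = 668) (T : Finset ι)
    (hT : ∀ f : ι → ℤ, ∑ y ∈ (univ : Finset ι), f y = ∑ t ∈ T, ∑ k ∈ Finset.range 334, f ((κ ^ k) t))
    (e2 : Fin 2 ≃ {t // t ∈ T}) :
    Function.Bijective (fun a : Fin 2 × ZMod 334 => (κ ^ a.2.val) (e2 a.1).1) := by
  rw [Fintype.bijective_iff_injective_and_card]
  refine ⟨fun a b hab => ?_, by simp [ZMod.card, hι]⟩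
  obtain ⟨h1, h2⟩ := orbitMap_unique κ T univ hT (e2 a.1).2 (e2 b.1).2 (ZMod.val_lt a.2) (ZMod.val_lt b.2)
    (Finset.mem_univ _) hab
  exact Prod.ext (e2.injective (Subtype.ext h1)) (ZMod.val_injective 334 h2)

section forward
variable {H : Matrix ι ι ℤ} {π κ : Equiv.Perm ι} {d e : ι → ℤ}

/-- the lifted difference `↑n − ↑m ∈ ZMod 668` of `m, n < 334` has `val = (n + 668 − m) % 668` -/
lemma val_cast_sub_cast {m n : ℕ} (hm : m < 334) (hn : n < 334) :
    (((n : ZMod 668) - (m : ZMod 668)).val) = (n + 668 - m) % 668 := by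
  have h : ((n : ZMod 668) - (m : ZMod 668)) = ((n + 668 - m : ℕ) : ZMod 668) := by
    rw [Nat.cast_sub (by omega), Nat.cast_add, show ((668 : ℕ) : ZMod 668) = 0 from by decide, add_zero]
  rw [h, ZMod.val_natCast]

omit [Fintype ι] [DecidableEq ι] in
/-- **the signed entry identity**: with all column cycle products `−1`, the signed cycle sequence of `Order334NegaPair668` at the
lifted difference equals the doubly re-signed entry `cyc_π(x, m)·cyc_κ(y, n)·H (π^m x) (κ^n y)`. -/
lemma nega_entry_identity (haut : IsSignedAut H π κ d e) (hκ : κ ^ 334 = 1) (hnegC : ∀ j, cyc κ e j 334 = -1)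
    (x y : ι) {m n : ℕ} (hm : m < 334) (hn : n < 334) :
    cyc κ e y (((n : ZMod 668) - (m : ZMod 668)).val) * H x ((κ ^ (((n : ZMod 668) - (m : ZMod 668)).val)) y) =
      cyc π d x m * cyc κ e y n * H ((π ^ m) x) ((κ ^ n) y) := by
  have hκ668 : κ ^ 668 = 1 := by rw [show (668 : ℕ) = 334 * 2 by norm_num, pow_mul, hκ, one_pow]
  rw [val_cast_sub_cast hm hn, cyc_mod_668_of_nega κ e hnegC y, pow_mod_of_pow_eq_one κ hκ668]
  set N := n + 668 - m with hN
  -- signed iteration at (x, κ^N y) with exponent m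
  have hit := signedAut_pow haut m x ((κ ^ N) y)
  rw [← Equiv.Perm.mul_apply, ← pow_add, show m + N = n + 668 by omega, pow_add, hκ668, mul_one] at hit
  -- cyc κ e (κ^N y) m = cyc y N * cyc y (N + m) = cyc y N * cyc y n
  have hca : cyc κ e y (N + m) = cyc κ e y N * cyc κ e ((κ ^ N) y) m := cyc_add κ e y N m
  have hper : cyc κ e y (N + m) = cyc κ e y n := by
    rw [show N + m = n + 668 * 1 by omega, cyc_add_668_mul_of_nega κ e hnegC y n 1]
  have h1 := pm_mul_self (cyc_pm κ e haut.2.1 y N)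
  have h2 := pm_mul_self (cyc_pm π d haut.1 x m)
  have h3 := pm_mul_self (cyc_pm κ e haut.2.1 y n)
  have hsolve : cyc κ e ((κ ^ N) y) m = cyc κ e y N * cyc κ e y n := by
    have := hca
    rw [hper] at this
    -- cyc y n = cyc y N * c  ⇒  c = cyc y N * cyc y n  (all ±1)
    calc cyc κ e ((κ ^ N) y) m = (cyc κ e y N * cyc κ e y N) * cyc κ e ((κ ^ N) y) m := by rw [h1, one_mul]
      _ = cyc κ e y N * (cyc κ e y N * cyc κ e ((κ ^ N) y) m) := by ring
      _ = cyc κ e y N * cyc κ e y n := by rw [← this]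
  rw [hit, hsolve]
  calc cyc κ e y N * H x ((κ ^ N) y)
      = (cyc π d x m * cyc π d x m) * (cyc κ e y n * cyc κ e y n) * (cyc κ e y N * H x ((κ ^ N) y)) := by
        rw [h2, h3]; ring
    _ = cyc π d x m * cyc κ e y n * (cyc π d x m * (cyc κ e y N * cyc κ e y n) * H x ((κ ^ N) y)) := by
        have := h1; ring

/-- **Order 334 ⇒ a `2 × 2` array of negacyclic blocks.** -/
theorem exists_negacyclicArray_of_hadamard668_signedAut_334 (hH : IsHadamardMatrix H) (hι : Fintype.card ι = 668)
    (haut : IsSignedAut H π κ d e) (hπ : π ^ 334 = 1) (hκ : κ ^ 334 = 1) (h2 : π ^ 2 ≠ 1 ∨ κ ^ 2 ≠ 1)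
    (h167 : π ^ 167 ≠ 1 ∨ κ ^ 167 ≠ 1) :
    ∃ x : Fin 2 → Fin 2 → ZMod 668 → ℤ, (∀ p q, IsPM (x p q)) ∧ (∀ p q r, x p q (r + 334) = -x p q r) ∧
      IsHadamardMatrix (Matrix.of fun (a b : Fin 2 × ZMod 334) => x a.1 b.1 ((b.2.val : ZMod 668) - (a.2.val : ZMod 668))) ∧
      Fintype.card (Fin 2 × ZMod 334) = 668 := by
  obtain ⟨hfreeR, hfreeC⟩ := hadamard668_order334_free hH hι haut hπ hκ h2 h167
  obtain ⟨-, hnegC⟩ := hadamard668_order334_nega hH hι haut hπ hκ h2 h167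
  have hκ668 : κ ^ 668 = 1 := by rw [show (668 : ℕ) = 334 * 2 by norm_num, pow_mul, hκ, one_pow]
  -- transversals and orbit coordinates
  have htr : ∀ ρ : Equiv.Perm ι, ρ ^ 334 = 1 → (∀ i k, 0 < k → k < 334 → (ρ ^ k) i ≠ i) →
      ∃ T : Finset ι, T.card = 2 ∧
        ∀ f : ι → ℤ, ∑ y ∈ (univ : Finset ι), f y = ∑ t ∈ T, ∑ k ∈ Finset.range 334, f ((ρ ^ k) t) := by
    intro ρ hρ hfree
    obtain ⟨T, -, hTc, hTs⟩ := exists_free_transversal ρ (by norm_num : 0 < 334) _ univ le_rfl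
      (fun y _ => Finset.mem_univ _) (fun y _ => by rw [hρ, Equiv.Perm.one_apply]) (fun y _ k hk0 hk => hfree y k hk0 hk)
    rw [Finset.card_univ, hι] at hTc
    exact ⟨T, by omega, hTs⟩
  obtain ⟨TR, hTR2, hTRs⟩ := htr π hπ hfreeR
  obtain ⟨TC, hTC2, hTCs⟩ := htr κ hκ hfreeC
  let eR2 : Fin 2 ≃ {t // t ∈ TR} := (Finset.equivFinOfCardEq hTR2).symm
  let eC2 : Fin 2 ≃ {t // t ∈ TC} := (Finset.equivFinOfCardEq hTC2).symm
  let fR : Fin 2 × ZMod 334 → ι := fun a => (π ^ a.2.val) (eR2 a.1).1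
  let fC : Fin 2 × ZMod 334 → ι := fun a => (κ ^ a.2.val) (eC2 a.1).1
  have hbR : Function.Bijective fR := orbitMap_bijective_334 π hι TR hTRs eR2
  have hbC : Function.Bijective fC := orbitMap_bijective_334 κ hι TC hTCs eC2
  let ER : Fin 2 × ZMod 334 ≃ ι := Equiv.ofBijective fR hbR
  let EC : Fin 2 × ZMod 334 ≃ ι := Equiv.ofBijective fC hbC
  -- the four antiperiodic sequences
  let x : Fin 2 → Fin 2 → ZMod 668 → ℤ := fun p q r => cyc κ e (eC2 q).1 r.val * H (eR2 p).1 ((κ ^ r.val) (eC2 q).1)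
  have hxpm : ∀ p q, IsPM (x p q) := by
    intro p q r
    rcases cyc_pm κ e haut.2.1 (eC2 q).1 r.val with h1 | h1 <;>
      rcases hH.1 (eR2 p).1 ((κ ^ r.val) (eC2 q).1) with h2 | h2 <;> simp [x, h1, h2]
  have hxanti : ∀ p q r, x p q (r + 334) = -x p q r := by
    intro p q r
    simp only [x]
    rw [ZMod.val_add, cyc_mod_668_of_nega κ e hnegC _, pow_mod_of_pow_eq_one κ hκ668,
      show (334 : ZMod 668).val = 334 from rfl, cyc_add_334_of_nega κ e hnegC _, pow_add, hκ, mul_one]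
    ring
  refine ⟨x, hxpm, hxanti, ?_, by simp [ZMod.card]⟩
  -- the array is the doubly re-signed, reindexed H
  let D : Fin 2 × ZMod 334 → ℤ := fun a => cyc π d (eR2 a.1).1 a.2.val
  let E : Fin 2 × ZMod 334 → ℤ := fun b => cyc κ e (eC2 b.1).1 b.2.val
  have hentry : ∀ a b : Fin 2 × ZMod 334,
      x a.1 b.1 ((b.2.val : ZMod 668) - (a.2.val : ZMod 668)) = D a * E b * H (ER a) (EC b) := by
    intro a b
    show cyc κ e (eC2 b.1).1 (((b.2.val : ZMod 668) - (a.2.val : ZMod 668)).val) *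
        H (eR2 a.1).1 ((κ ^ (((b.2.val : ZMod 668) - (a.2.val : ZMod 668)).val)) (eC2 b.1).1) =
      cyc π d (eR2 a.1).1 a.2.val * cyc κ e (eC2 b.1).1 b.2.val *
        H ((π ^ a.2.val) (eR2 a.1).1) ((κ ^ b.2.val) (eC2 b.1).1)
    exact nega_entry_identity haut hκ hnegC _ _ (ZMod.val_lt a.2) (ZMod.val_lt b.2)
  have hDpm : ∀ a, D a * D a = 1 := fun a => pm_mul_self (cyc_pm π d haut.1 _ _)
  have hEpm : ∀ b, E b * E b = 1 := fun b => pm_mul_self (cyc_pm κ e haut.2.1 _ _)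
  refine ⟨fun a b => hxpm a.1 b.1 _, ?_⟩
  ext a a'
  rw [Matrix.mul_apply, Matrix.smul_apply, Matrix.one_apply]
  simp only [Matrix.transpose_apply, Matrix.of_apply, hentry]
  have hre : ∑ b : Fin 2 × ZMod 334, D a * E b * H (ER a) (EC b) * (D a' * E b * H (ER a') (EC b)) =
      D a * D a' * ∑ b : Fin 2 × ZMod 334, H (ER a) (EC b) * H (ER a') (EC b) := by
    rw [Finset.mul_sum]
    refine Finset.sum_congr rfl fun b _ => ?_
    calc D a * E b * H (ER a) (EC b) * (D a' * E b * H (ER a') (EC b))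
        = D a * D a' * (E b * E b) * (H (ER a) (EC b) * H (ER a') (EC b)) := by ring
      _ = D a * D a' * (H (ER a) (EC b) * H (ER a') (EC b)) := by rw [hEpm b]; ring
  rw [hre, Equiv.sum_comp EC (fun y => H (ER a) y * H (ER a') y)]
  by_cases haa : a = a'
  · subst haa
    rw [hadamard_row_self H hH, hDpm a, one_mul, if_pos rfl, hι]
    simp [ZMod.card]
  · rw [hadamard_row_orth H hH (fun h => haa (ER.injective h)), if_neg haa, mul_zero, smul_zero]

end forward

/-! ### the converse and the dictionary statement -/

/-- value of `(s + 1).val` in `ZMod 334`: `s.val + 1` unless `s = 333` -/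
lemma zmod334_val_add_one (s : ZMod 334) :
    ((s + 1).val = s.val + 1 ∧ s.val < 333) ∨ ((s + 1).val = 0 ∧ s.val = 333) := by
  have hs := ZMod.val_lt s
  rw [ZMod.val_add, show (1 : ZMod 334).val = 1 from rfl]
  rcases Nat.lt_or_ge (s.val + 1) 334 with h | h
  · left; exact ⟨Nat.mod_eq_of_lt h, by omega⟩
  · right; refine ⟨?_, by omega⟩
    rw [show s.val + 1 = 334 by omega]

/-- **A `2 × 2` array of negacyclic blocks of order 334 has the signed shift as an automorphism of pair order `334`.** -/
theorem hadamard668_negacyclicArray_aut334 (x : Fin 2 → Fin 2 → ZMod 668 → ℤ)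
    (hanti : ∀ p q r, x p q (r + 334) = -x p q r) :
    IsSignedAut (Matrix.of fun (a b : Fin 2 × ZMod 334) => x a.1 b.1 ((b.2.val : ZMod 668) - (a.2.val : ZMod 668)))
        (Equiv.prodCongr (Equiv.refl (Fin 2)) (Equiv.addRight (1 : ZMod 334)))
        (Equiv.prodCongr (Equiv.refl (Fin 2)) (Equiv.addRight (1 : ZMod 334)))
        (fun a => if a.2.val = 333 then -1 else 1) (fun a => if a.2.val = 333 then -1 else 1) ∧
      Fintype.card (Fin 2 × ZMod 334) = 668 ∧
      orderOf ((Equiv.prodCongr (Equiv.refl (Fin 2)) (Equiv.addRight (1 : ZMod 334)),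
                Equiv.prodCongr (Equiv.refl (Fin 2)) (Equiv.addRight (1 : ZMod 334))) :
        Equiv.Perm (Fin 2 × ZMod 334) × Equiv.Perm (Fin 2 × ZMod 334)) = 334 := by
  set σ : Equiv.Perm (Fin 2 × ZMod 334) := Equiv.prodCongr (Equiv.refl (Fin 2)) (Equiv.addRight (1 : ZMod 334)) with hσ
  have hanti' : ∀ p q r, x p q (r - 334) = -x p q r := by
    intro p q r
    have := hanti p q (r - 334)
    rw [sub_add_cancel] at this
    rw [this, neg_neg]
  have hpm : ∀ a : Fin 2 × ZMod 334, (fun a : Fin 2 × ZMod 334 => if a.2.val = 333 then (-1 : ℤ) else 1) a = 1 ∨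
      (fun a : Fin 2 × ZMod 334 => if a.2.val = 333 then (-1 : ℤ) else 1) a = -1 := by
    intro a
    dsimp only
    split_ifs <;> simp
  refine ⟨⟨hpm, hpm, fun a b => ?_⟩, by simp [ZMod.card], ?_⟩
  · obtain ⟨p, s⟩ := a
    obtain ⟨q, t⟩ := b
    simp only [hσ, Equiv.prodCongr_apply, Prod.map_apply, Equiv.coe_refl, id_eq, Equiv.coe_addRight, Matrix.of_apply]
    rcases zmod334_val_add_one s with ⟨hs, hs'⟩ | ⟨hs, hs'⟩ <;> rcases zmod334_val_add_one t with ⟨ht, ht'⟩ | ⟨ht, ht'⟩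
    · have e1 : (((s + 1).val : ℕ) : ZMod 668) = (s.val : ZMod 668) + 1 := by rw [hs]; push_cast; ring
      have e2 : (((t + 1).val : ℕ) : ZMod 668) = (t.val : ZMod 668) + 1 := by rw [ht]; push_cast; ring
      rw [e1, e2, if_neg (by omega : ¬ s.val = 333), if_neg (by omega : ¬ t.val = 333),
        show (t.val : ZMod 668) + 1 - ((s.val : ZMod 668) + 1) = (t.val : ZMod 668) - (s.val : ZMod 668) by ring]
      ring
    · have e1 : (((s + 1).val : ℕ) : ZMod 668) = (s.val : ZMod 668) + 1 := by rw [hs]; push_cast; ring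
      have e2 : (((t + 1).val : ℕ) : ZMod 668) = 0 := by rw [ht]; push_cast; ring
      rw [e1, e2, if_neg (by omega : ¬ s.val = 333), if_pos ht',
        show (0 : ZMod 668) - ((s.val : ZMod 668) + 1) = ((t.val : ZMod 668) - (s.val : ZMod 668)) - 334 by
          rw [ht']; push_cast; ring, hanti']
      ring
    · have e1 : (((s + 1).val : ℕ) : ZMod 668) = 0 := by rw [hs]; push_cast; ring
      have e2 : (((t + 1).val : ℕ) : ZMod 668) = (t.val : ZMod 668) + 1 := by rw [ht]; push_cast; ring
      rw [e1, e2, if_pos hs', if_neg (by omega : ¬ t.val = 333),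
        show (t.val : ZMod 668) + 1 - 0 = ((t.val : ZMod 668) - (s.val : ZMod 668)) + 334 by
          rw [hs']; push_cast; ring, hanti]
      ring
    · have e1 : (((s + 1).val : ℕ) : ZMod 668) = 0 := by rw [hs]; push_cast; ring
      have e2 : (((t + 1).val : ℕ) : ZMod 668) = 0 := by rw [ht]; push_cast; ring
      rw [e1, e2, if_pos hs', if_pos ht', hs', ht', sub_self, sub_self]
      ring
  · -- orderOf (σ, σ) = 334
    have hσapp : ∀ k : ℕ, ∀ a : Fin 2 × ZMod 334, (σ ^ k) a = (a.1, a.2 + k) := by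
      intro k
      induction k with
      | zero => intro a; simp
      | succ k ih =>
        intro a
        rw [pow_succ', Equiv.Perm.mul_apply, ih, Nat.cast_succ, ← add_assoc]
        rfl
    have h334 : σ ^ 334 = 1 := by
      ext a
      · rw [hσapp]; rfl
      · rw [hσapp, Equiv.Perm.one_apply, ZMod.natCast_self, add_zero]
    have h2 : σ ^ 2 ≠ 1 := by
      intro h
      have h' := congrArg (fun ρ : Equiv.Perm (Fin 2 × ZMod 334) => (ρ ((0 : Fin 2), (0 : ZMod 334))).2) h
      simp only [hσapp, Equiv.Perm.one_apply, zero_add] at h'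
      exact absurd h' (by decide)
    have h167 : σ ^ 167 ≠ 1 := by
      intro h
      have h' := congrArg (fun ρ : Equiv.Perm (Fin 2 × ZMod 334) => (ρ ((0 : Fin 2), (0 : ZMod 334))).2) h
      simp only [hσapp, Equiv.Perm.one_apply, zero_add] at h'
      exact absurd h' (by decide)
    set y : Equiv.Perm (Fin 2 × ZMod 334) × Equiv.Perm (Fin 2 × ZMod 334) := (σ, σ) with hy
    have hy334 : y ^ 334 = 1 := by rw [hy, Prod.pow_mk, h334]; rfl
    have hdvd : orderOf y ∣ 334 := orderOf_dvd_of_pow_eq_one hy334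
    have hmem : orderOf y ∈ Nat.divisors 334 := Nat.mem_divisors.mpr ⟨hdvd, by norm_num⟩
    have hdiv : Nat.divisors 334 = {1, 2, 167, 334} := by decide
    rw [hdiv] at hmem
    simp only [Finset.mem_insert, Finset.mem_singleton] at hmem
    have hne2 : ¬ orderOf y ∣ 2 := by
      intro h
      have h1 : y ^ 2 = 1 := orderOf_dvd_iff_pow_eq_one.mp h
      rw [hy, Prod.pow_mk, Prod.mk_eq_one] at h1
      exact h2 h1.1
    have hne167 : ¬ orderOf y ∣ 167 := by
      intro h
      have h1 : y ^ 167 = 1 := orderOf_dvd_iff_pow_eq_one.mp h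
      rw [hy, Prod.pow_mk, Prod.mk_eq_one] at h1
      exact h167 h1.1
    rcases hmem with h | h | h | h
    · exact absurd (by rw [h]; exact one_dvd 2) hne2
    · exact absurd (by rw [h]) hne2
    · exact absurd (by rw [h]) hne167
    · exact h

/-- **The dictionary, order 334.**  *Some Hadamard matrix of order `668` has a signed automorphism whose permutation pair has
order `334`* **iff** *some Hadamard matrix of order `668` is a `2 × 2` array of negacyclic `±1` blocks of order `334`
(on antiperiodic sequences).* -/
theorem hadamard668_aut334_iff_negacyclicArray :
    (∃ (ι : Type) (_ : Fintype ι) (_ : DecidableEq ι) (H : Matrix ι ι ℤ) (π κ : Equiv.Perm ι) (d e : ι → ℤ),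
        Fintype.card ι = 668 ∧ IsHadamardMatrix H ∧ IsSignedAut H π κ d e ∧
        orderOf ((π, κ) : Equiv.Perm ι × Equiv.Perm ι) = 334) ↔
    ∃ x : Fin 2 → Fin 2 → ZMod 668 → ℤ, (∀ p q r, x p q (r + 334) = -x p q r) ∧
      IsHadamardMatrix (Matrix.of fun (a b : Fin 2 × ZMod 334) => x a.1 b.1 ((b.2.val : ZMod 668) - (a.2.val : ZMod 668))) := by
  constructor
  · rintro ⟨ι, _, _, H, π, κ, d, e, hι, hH, haut, hord⟩
    obtain ⟨hπ, hκ, h2⟩ := pow_data_of_orderOf hord (a := 2) (by norm_num) (by norm_num)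
    obtain ⟨-, -, h167⟩ := pow_data_of_orderOf hord (a := 167) (by norm_num) (by norm_num)
    obtain ⟨x, -, hanti, hM, -⟩ := exists_negacyclicArray_of_hadamard668_signedAut_334 hH hι haut hπ hκ h2 h167
    exact ⟨x, hanti, hM⟩
  · rintro ⟨x, hanti, hM⟩
    obtain ⟨haut, hcard, hord⟩ := hadamard668_negacyclicArray_aut334 x hanti
    exact ⟨Fin 2 × ZMod 334, inferInstance, inferInstance, _, _, _, _, _, hcard, hM, haut, hord⟩

end Summit.Ventures.DiscreteObjects.Hadamard
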